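import Summits.QuantumFields.YangMills.Theorems.ChatterjeeMassGapTorusAxialOneBitBoxIntegral
import HarnessLib

/-!
# Uniqueness of the box of the one bit: search branch 4 of 5 (item 8941 lane; ym-dw-p1 g6)

For the perpendicular pair `q₁ = Q_0^{(12)} = (0;1,2)`, `q₂ = P_{e₀}^{(01)} = (e₀;0,1)` of the `S28ᵀ`
witness, the bond `(0, e₁)` of `q₁` must be covered, in any family without private bonds containing
`q₁, q₂`, by one of the five other plaquettes of `ℤ⁴` containing it. This file treats candidate
no. 4, `p = ((0, 0, 0, 0), 0, 1)`: every family `T ⊇ {q₁, q₂, p}` of at most ten plaquettes without private bonds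
contains the ten faces of the box `∂([0,2]_0 × [0,1]_1 × [0,1]_2 × {0})` (`box_branch4`). Proof:
the bond `((2, 0, 0, 0), 1)` is private in `{q₁, q₂, p}`, so it is covered by one of the plaquettes containing it
(`plaquettesTouching`); for each such sub-branch an explicit search certificate (a `Nat.rec` term:
cover some private bond by each plaquette containing it; prune when more than `4 · fuel` private
bonds remain) is evaluated by the kernel (`decide +kernel`) and combined with its soundness
(`subset_of_GS`). The device is written out privately in each of the five branch files on purpose
(it bounds the kernel time of each file and introduces no definitions); the assembly is
`…OneBitBoxUnique`. No statement about Gibbs states is made here; no mass gap is claimed.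
-/

namespace Summit.QuantumFields.YangMills.Theorems.S28OneBitBox

open Finset
open Literature.MathematicalPhysics.QuantumLattice (ZdEdge ZdPlaquette plaquetteEdges plaquettesTouching
  mem_plaquettesTouching_iff)

/-- `1 < 3` in `Fin 4` (plane label of the `(1,3)`-plaquettes). -/
private theorem lt13 : ((1 : Fin 4), (3 : Fin 4)).1 < ((1 : Fin 4), (3 : Fin 4)).2 := by decide

/-- `0 < 3` in `Fin 4` (plane label of the `(0,3)`-plaquettes). -/
private theorem lt03 : ((0 : Fin 4), (3 : Fin 4)).1 < ((0 : Fin 4), (3 : Fin 4)).2 := by decide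

/-- `2 < 3` in `Fin 4` (plane label of the `(2,3)`-plaquettes). -/
private theorem lt23 : ((2 : Fin 4), (3 : Fin 4)).1 < ((2 : Fin 4), (3 : Fin 4)).2 := by decide

/-! ### The search device (definition-free: the certificate is an explicit `Nat.rec` term)

`PB(T) = ((T.biUnion plaquetteEdges).filter fun ℓ => #(T.filter (ℓ ∈ edges ·)) = 1)` is the set of
PRIVATE BONDS of `T` (bonds of members lying in exactly one member); the certificate `GS(B, k, T)`
(fuel `k`) is `true` iff: `T` has no private bond and equals `B`; or it has more than `4k` private
bonds; or some private bond `ℓ` is such that every plaquette containing `ℓ` and not in `T` gives,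
once added, a certified state with fuel `k - 1`. -/

/-- Membership in the set of private bonds. -/
private theorem mem_PB {T : Finset (ZdPlaquette 4)} {ℓ : ZdEdge 4} :
    ℓ ∈ ((T).biUnion plaquetteEdges).filter (fun ℓ => ((T).filter fun p => ℓ ∈ plaquetteEdges p).card = 1) ↔
      (∃ p ∈ T, ℓ ∈ plaquetteEdges p) ∧ (T.filter fun p => ℓ ∈ plaquetteEdges p).card = 1 := by
  simp only [Finset.mem_filter, Finset.mem_biUnion]

/-- No private bonds iff every bond of every member lies in another member. -/
private theorem PB_eq_empty_iff (T : Finset (ZdPlaquette 4)) :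
    ((T).biUnion plaquetteEdges).filter (fun ℓ => ((T).filter fun p => ℓ ∈ plaquetteEdges p).card = 1) = ∅ ↔
      ∀ p ∈ T, ∀ ℓ ∈ plaquetteEdges p, ∃ p' ∈ T, p' ≠ p ∧ ℓ ∈ plaquetteEdges p' := by
  constructor
  · intro h p hp ℓ hℓ
    by_contra hne
    push Not at hne
    have hmem : ℓ ∈ ((T).biUnion plaquetteEdges).filter (fun ℓ => ((T).filter fun p => ℓ ∈ plaquetteEdges p).card =
        1) := by
      rw [mem_PB]
      refine ⟨⟨p, hp, hℓ⟩, ?_⟩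
      rw [Finset.card_eq_one]
      refine ⟨p, Finset.eq_singleton_iff_unique_mem.2 ⟨Finset.mem_filter.2 ⟨hp, hℓ⟩, fun p' hp' => ?_⟩⟩
      obtain ⟨hp'T, hℓp'⟩ := Finset.mem_filter.1 hp'
      by_contra hne'
      exact hne p' hp'T hne' hℓp'
    rw [h] at hmem
    simp at hmem
  · intro h
    rw [Finset.eq_empty_iff_forall_notMem]
    intro ℓ hℓ
    rw [mem_PB] at hℓ
    obtain ⟨⟨p, hp, hℓp⟩, hcard⟩ := hℓ
    obtain ⟨p', hp'T, hne, hℓp'⟩ := h p hp ℓ hℓp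
    have h2 : 2 ≤ (T.filter fun q => ℓ ∈ plaquetteEdges q).card := by
      have hsub : ({p, p'} : Finset (ZdPlaquette 4)) ⊆ T.filter fun q => ℓ ∈ plaquetteEdges q := by
        intro q hq
        rcases Finset.mem_insert.1 hq with rfl | hq
        · exact Finset.mem_filter.2 ⟨hp, hℓp⟩
        · rw [Finset.mem_singleton] at hq; subst hq; exact Finset.mem_filter.2 ⟨hp'T, hℓp'⟩
      calc 2 = ({p, p'} : Finset (ZdPlaquette 4)).card := (Finset.card_pair hne.symm).symm
        _ ≤ _ := Finset.card_le_card hsub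
    omega

/-- Covering: if `T ⊆ T'` and `T'` has no private bonds, every private bond of `T` lies in a
plaquette of `T' ∖ T`. -/
private theorem exists_mem_sdiff_of_mem_PB {T T' : Finset (ZdPlaquette 4)} (hTT' : T ⊆ T')
    (hN : ((T').biUnion plaquetteEdges).filter (fun ℓ => ((T').filter fun p => ℓ ∈ plaquetteEdges p).card = 1) = ∅)
    {ℓ : ZdEdge 4} (hℓ : ℓ ∈ ((T).biUnion plaquetteEdges).filter (fun ℓ => ((T).filter fun p => ℓ ∈ plaquetteEdges p).card = 1)) :
    ∃ p'' ∈ T' \ T, ℓ ∈ plaquetteEdges p'' := by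
  rw [mem_PB] at hℓ
  obtain ⟨⟨p, hp, hℓp⟩, hcard⟩ := hℓ
  rw [PB_eq_empty_iff] at hN
  obtain ⟨p', hp'T', hne, hℓp'⟩ := hN p (hTT' hp) ℓ hℓp
  refine ⟨p', Finset.mem_sdiff.2 ⟨hp'T', fun hp'T => ?_⟩, hℓp'⟩
  rw [Finset.card_eq_one] at hcard
  obtain ⟨a, ha⟩ := hcard
  have h1 : p ∈ ({a} : Finset (ZdPlaquette 4)) := ha ▸ Finset.mem_filter.2 ⟨hp, hℓp⟩
  have h2 : p' ∈ ({a} : Finset (ZdPlaquette 4)) := ha ▸ Finset.mem_filter.2 ⟨hp'T, hℓp'⟩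
  rw [Finset.mem_singleton] at h1 h2
  exact hne (h2.trans h1.symm)

/-- Counting: if `T ⊆ T'` and `T'` has no private bonds, `T` has at most `4 · #(T' ∖ T)` private
bonds. -/
private theorem card_PB_le {T T' : Finset (ZdPlaquette 4)} (hTT' : T ⊆ T')
    (hN : ((T').biUnion plaquetteEdges).filter (fun ℓ => ((T').filter fun p => ℓ ∈ plaquetteEdges p).card = 1) = ∅) :
    (((T).biUnion plaquetteEdges).filter (fun ℓ => ((T).filter fun p => ℓ ∈ plaquetteEdges p).card = 1)).card ≤ 4 *
        (T' \ T).card := by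
  classical
  have hsub : ((T).biUnion plaquetteEdges).filter (fun ℓ => ((T).filter fun p => ℓ ∈ plaquetteEdges p).card = 1) ⊆
      (T' \ T).biUnion plaquetteEdges := fun ℓ hℓ => by
    obtain ⟨p'', hp'', hℓp''⟩ := exists_mem_sdiff_of_mem_PB hTT' hN hℓ
    exact Finset.mem_biUnion.2 ⟨p'', hp'', hℓp''⟩
  refine (Finset.card_le_card hsub).trans ((Finset.card_biUnion_le).trans ?_)
  calc ∑ p ∈ T' \ T, (plaquetteEdges p).card ≤ ∑ _p ∈ T' \ T, 4 :=
        Finset.sum_le_sum fun p _ => Finset.card_le_four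
    _ = 4 * (T' \ T).card := by rw [Finset.sum_const, smul_eq_mul, mul_comm]

/-- **Soundness of the search certificate.** If `GS(B, k, T) = true`, every family `T' ⊇ T` without
private bonds and with at most `#T + k` members contains `B`. -/
private theorem subset_of_GS (B : Finset (ZdPlaquette 4)) :
    ∀ (k : ℕ) (T : Finset (ZdPlaquette 4)),
      @Nat.rec (fun _ => Finset (ZdPlaquette 4) → Bool)
        (fun T => if ((T).biUnion plaquetteEdges).filter (fun ℓ => ((T).filter fun p => ℓ ∈ plaquetteEdges p).card =
            1) = ∅ then decide (T = B) else true)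
        (fun k ih T => if ((T).biUnion plaquetteEdges).filter (fun ℓ => ((T).filter fun p => ℓ ∈ plaquetteEdges p).card = 1) = ∅ then decide (T = B)
          else decide (4 * (k + 1) < (((T).biUnion plaquetteEdges).filter (fun ℓ => ((T).filter fun p => ℓ ∈ plaquetteEdges p).card = 1)).card) ||
            decide (∃ ℓ ∈ ((T).biUnion plaquetteEdges).filter (fun ℓ => ((T).filter fun p => ℓ ∈ plaquetteEdges p).card = 1), ∀ p' ∈ plaquettesTouching {ℓ}, p' ∉ T → ih (insert p' T) = true))
        (k) (T) = true →
      ∀ T' : Finset (ZdPlaquette 4), T ⊆ T' → T'.card ≤ T.card + k →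
        ((T').biUnion plaquetteEdges).filter (fun ℓ => ((T').filter fun p => ℓ ∈ plaquetteEdges p).card = 1) =
            ∅ → B ⊆ T' := by
  classical
  intro k
  induction k with
  | zero =>
    intro T hg T' hTT' hcard hN
    simp only [Nat.rec_zero] at hg
    by_cases h0 : ((T).biUnion plaquetteEdges).filter (fun ℓ => ((T).filter fun p => ℓ ∈ plaquetteEdges p).card =
        1) = ∅
    · simp only [h0, ↓reduceIte, decide_eq_true_eq] at hg
      exact hg ▸ hTT'
    · obtain ⟨ℓ, hℓ⟩ := Finset.nonempty_iff_ne_empty.2 h0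
      obtain ⟨p'', hp'', -⟩ := exists_mem_sdiff_of_mem_PB hTT' hN hℓ
      have : (T' \ T).card = 0 := by
        rw [Finset.card_sdiff_of_subset hTT']; omega
      rw [Finset.card_eq_zero] at this
      rw [this] at hp''
      simp at hp''
  | succ k ih =>
    intro T hg T' hTT' hcard hN
    by_cases h0 : ((T).biUnion plaquetteEdges).filter (fun ℓ => ((T).filter fun p => ℓ ∈ plaquetteEdges p).card =
        1) = ∅
    · simp only [h0, ↓reduceIte, decide_eq_true_eq] at hg
      exact hg ▸ hTT'
    · simp only [h0, ↓reduceIte, Bool.or_eq_true, decide_eq_true_eq] at hg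
      have hsd : (T' \ T).card ≤ k + 1 := by
        rw [Finset.card_sdiff_of_subset hTT']; omega
      rcases hg with hbig | ⟨ℓ, hℓ, hstep⟩
      · have := card_PB_le hTT' hN
        omega
      · obtain ⟨p'', hp'', hℓp''⟩ := exists_mem_sdiff_of_mem_PB hTT' hN hℓ
        obtain ⟨hp''T', hp''T⟩ := Finset.mem_sdiff.1 hp''
        have htouch : p'' ∈ plaquettesTouching ({ℓ} : Finset (ZdEdge 4)) :=
          mem_plaquettesTouching_iff.2 ⟨ℓ, Finset.mem_inter.2 ⟨hℓp'', Finset.mem_singleton_self _⟩⟩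
        have hg' := hstep p'' htouch hp''T
        refine ih (insert p'' T) hg' T' (Finset.insert_subset hp''T' hTT') ?_ hN
        rw [Finset.card_insert_of_notMem hp''T]; omega

set_option maxRecDepth 1000000 in
/-- Search certificate for branch 4, sub-branch 1 (kernel computation). -/
private theorem GS_branch4_1 :
    @Nat.rec (fun _ => Finset (ZdPlaquette 4) → Bool)
        (fun T => if ((T).biUnion plaquetteEdges).filter (fun ℓ => ((T).filter fun p => ℓ ∈ plaquetteEdges p).card =
            1) = ∅ then decide (T = ({(![0,0,0,0], ⟨(1, 2), lt12⟩), (![1,0,0,0], ⟨(0, 1), lt01⟩), (![2,0,0,0], ⟨(1,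
            2), lt12⟩), (![0,0,0,0], ⟨(0, 1), lt01⟩), (![0,0,1,0], ⟨(0, 1), lt01⟩), (![0,0,0,0], ⟨(0, 2), lt02⟩),
            (![0,1,0,0], ⟨(0, 2), lt02⟩), (![1,0,1,0], ⟨(0, 1), lt01⟩), (![1,0,0,0], ⟨(0, 2), lt02⟩), (![1,1,0,0],
            ⟨(0, 2), lt02⟩)} : Finset (ZdPlaquette 4))) else true)
        (fun k ih T => if ((T).biUnion plaquetteEdges).filter (fun ℓ => ((T).filter fun p => ℓ ∈ plaquetteEdges p).card = 1) = ∅ then decide (T = ({(![0,0,0,0], ⟨(1, 2), lt12⟩), (![1,0,0,0], ⟨(0, 1), lt01⟩), (![2,0,0,0], ⟨(1, 2), lt12⟩), (![0,0,0,0], ⟨(0, 1), lt01⟩), (![0,0,1,0], ⟨(0, 1), lt01⟩), (![0,0,0,0], ⟨(0, 2), lt02⟩), (![0,1,0,0], ⟨(0, 2), lt02⟩), (![1,0,1,0], ⟨(0, 1), lt01⟩), (![1,0,0,0], ⟨(0, 2), lt02⟩), (![1,1,0,0], ⟨(0, 2), lt02⟩)} : Finset (ZdPlaquette 4)))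
          else decide (4 * (k + 1) < (((T).biUnion plaquetteEdges).filter (fun ℓ => ((T).filter fun p => ℓ ∈ plaquetteEdges p).card = 1)).card) ||
            decide (∃ ℓ ∈ ((T).biUnion plaquetteEdges).filter (fun ℓ => ((T).filter fun p => ℓ ∈ plaquetteEdges p).card = 1), ∀ p' ∈ plaquettesTouching {ℓ}, p' ∉ T → ih (insert p' T) = true))
        (6) ((insert (![2,0,0,0], ⟨(0, 1), lt01⟩)
          ({(![0,0,0,0], ⟨(1, 2), lt12⟩), (![1,0,0,0], ⟨(0, 1), lt01⟩), (![0,0,0,0], ⟨(0, 1),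
              lt01⟩)} : Finset (ZdPlaquette 4)))) = true := by
  decide +kernel

set_option maxRecDepth 1000000 in
/-- Search certificate for branch 4, sub-branch 2 (kernel computation). -/
private theorem GS_branch4_2 :
    @Nat.rec (fun _ => Finset (ZdPlaquette 4) → Bool)
        (fun T => if ((T).biUnion plaquetteEdges).filter (fun ℓ => ((T).filter fun p => ℓ ∈ plaquetteEdges p).card =
            1) = ∅ then decide (T = ({(![0,0,0,0], ⟨(1, 2), lt12⟩), (![1,0,0,0], ⟨(0, 1), lt01⟩), (![2,0,0,0], ⟨(1,
            2), lt12⟩), (![0,0,0,0], ⟨(0, 1), lt01⟩), (![0,0,1,0], ⟨(0, 1), lt01⟩), (![0,0,0,0], ⟨(0, 2), lt02⟩),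
            (![0,1,0,0], ⟨(0, 2), lt02⟩), (![1,0,1,0], ⟨(0, 1), lt01⟩), (![1,0,0,0], ⟨(0, 2), lt02⟩), (![1,1,0,0],
            ⟨(0, 2), lt02⟩)} : Finset (ZdPlaquette 4))) else true)
        (fun k ih T => if ((T).biUnion plaquetteEdges).filter (fun ℓ => ((T).filter fun p => ℓ ∈ plaquetteEdges p).card = 1) = ∅ then decide (T = ({(![0,0,0,0], ⟨(1, 2), lt12⟩), (![1,0,0,0], ⟨(0, 1), lt01⟩), (![2,0,0,0], ⟨(1, 2), lt12⟩), (![0,0,0,0], ⟨(0, 1), lt01⟩), (![0,0,1,0], ⟨(0, 1), lt01⟩), (![0,0,0,0], ⟨(0, 2), lt02⟩), (![0,1,0,0], ⟨(0, 2), lt02⟩), (![1,0,1,0], ⟨(0, 1), lt01⟩), (![1,0,0,0], ⟨(0, 2), lt02⟩), (![1,1,0,0], ⟨(0, 2), lt02⟩)} : Finset (ZdPlaquette 4)))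
          else decide (4 * (k + 1) < (((T).biUnion plaquetteEdges).filter (fun ℓ => ((T).filter fun p => ℓ ∈ plaquetteEdges p).card = 1)).card) ||
            decide (∃ ℓ ∈ ((T).biUnion plaquetteEdges).filter (fun ℓ => ((T).filter fun p => ℓ ∈ plaquetteEdges p).card = 1), ∀ p' ∈ plaquettesTouching {ℓ}, p' ∉ T → ih (insert p' T) = true))
        (6) ((insert (![2,0,0,0], ⟨(1, 2), lt12⟩)
          ({(![0,0,0,0], ⟨(1, 2), lt12⟩), (![1,0,0,0], ⟨(0, 1), lt01⟩), (![0,0,0,0], ⟨(0, 1),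
              lt01⟩)} : Finset (ZdPlaquette 4)))) = true := by
  decide +kernel

set_option maxRecDepth 1000000 in
/-- Search certificate for branch 4, sub-branch 3 (kernel computation). -/
private theorem GS_branch4_3 :
    @Nat.rec (fun _ => Finset (ZdPlaquette 4) → Bool)
        (fun T => if ((T).biUnion plaquetteEdges).filter (fun ℓ => ((T).filter fun p => ℓ ∈ plaquetteEdges p).card =
            1) = ∅ then decide (T = ({(![0,0,0,0], ⟨(1, 2), lt12⟩), (![1,0,0,0], ⟨(0, 1), lt01⟩), (![2,0,0,0], ⟨(1,
            2), lt12⟩), (![0,0,0,0], ⟨(0, 1), lt01⟩), (![0,0,1,0], ⟨(0, 1), lt01⟩), (![0,0,0,0], ⟨(0, 2), lt02⟩),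
            (![0,1,0,0], ⟨(0, 2), lt02⟩), (![1,0,1,0], ⟨(0, 1), lt01⟩), (![1,0,0,0], ⟨(0, 2), lt02⟩), (![1,1,0,0],
            ⟨(0, 2), lt02⟩)} : Finset (ZdPlaquette 4))) else true)
        (fun k ih T => if ((T).biUnion plaquetteEdges).filter (fun ℓ => ((T).filter fun p => ℓ ∈ plaquetteEdges p).card = 1) = ∅ then decide (T = ({(![0,0,0,0], ⟨(1, 2), lt12⟩), (![1,0,0,0], ⟨(0, 1), lt01⟩), (![2,0,0,0], ⟨(1, 2), lt12⟩), (![0,0,0,0], ⟨(0, 1), lt01⟩), (![0,0,1,0], ⟨(0, 1), lt01⟩), (![0,0,0,0], ⟨(0, 2), lt02⟩), (![0,1,0,0], ⟨(0, 2), lt02⟩), (![1,0,1,0], ⟨(0, 1), lt01⟩), (![1,0,0,0], ⟨(0, 2), lt02⟩), (![1,1,0,0], ⟨(0, 2), lt02⟩)} : Finset (ZdPlaquette 4)))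
          else decide (4 * (k + 1) < (((T).biUnion plaquetteEdges).filter (fun ℓ => ((T).filter fun p => ℓ ∈ plaquetteEdges p).card = 1)).card) ||
            decide (∃ ℓ ∈ ((T).biUnion plaquetteEdges).filter (fun ℓ => ((T).filter fun p => ℓ ∈ plaquetteEdges p).card = 1), ∀ p' ∈ plaquettesTouching {ℓ}, p' ∉ T → ih (insert p' T) = true))
        (6) ((insert (![2,0,-1,0], ⟨(1, 2), lt12⟩)
          ({(![0,0,0,0], ⟨(1, 2), lt12⟩), (![1,0,0,0], ⟨(0, 1), lt01⟩), (![0,0,0,0], ⟨(0, 1),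
              lt01⟩)} : Finset (ZdPlaquette 4)))) = true := by
  decide +kernel

set_option maxRecDepth 1000000 in
/-- Search certificate for branch 4, sub-branch 4 (kernel computation). -/
private theorem GS_branch4_4 :
    @Nat.rec (fun _ => Finset (ZdPlaquette 4) → Bool)
        (fun T => if ((T).biUnion plaquetteEdges).filter (fun ℓ => ((T).filter fun p => ℓ ∈ plaquetteEdges p).card =
            1) = ∅ then decide (T = ({(![0,0,0,0], ⟨(1, 2), lt12⟩), (![1,0,0,0], ⟨(0, 1), lt01⟩), (![2,0,0,0], ⟨(1,
            2), lt12⟩), (![0,0,0,0], ⟨(0, 1), lt01⟩), (![0,0,1,0], ⟨(0, 1), lt01⟩), (![0,0,0,0], ⟨(0, 2), lt02⟩),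
            (![0,1,0,0], ⟨(0, 2), lt02⟩), (![1,0,1,0], ⟨(0, 1), lt01⟩), (![1,0,0,0], ⟨(0, 2), lt02⟩), (![1,1,0,0],
            ⟨(0, 2), lt02⟩)} : Finset (ZdPlaquette 4))) else true)
        (fun k ih T => if ((T).biUnion plaquetteEdges).filter (fun ℓ => ((T).filter fun p => ℓ ∈ plaquetteEdges p).card = 1) = ∅ then decide (T = ({(![0,0,0,0], ⟨(1, 2), lt12⟩), (![1,0,0,0], ⟨(0, 1), lt01⟩), (![2,0,0,0], ⟨(1, 2), lt12⟩), (![0,0,0,0], ⟨(0, 1), lt01⟩), (![0,0,1,0], ⟨(0, 1), lt01⟩), (![0,0,0,0], ⟨(0, 2), lt02⟩), (![0,1,0,0], ⟨(0, 2), lt02⟩), (![1,0,1,0], ⟨(0, 1), lt01⟩), (![1,0,0,0], ⟨(0, 2), lt02⟩), (![1,1,0,0], ⟨(0, 2), lt02⟩)} : Finset (ZdPlaquette 4)))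
          else decide (4 * (k + 1) < (((T).biUnion plaquetteEdges).filter (fun ℓ => ((T).filter fun p => ℓ ∈ plaquetteEdges p).card = 1)).card) ||
            decide (∃ ℓ ∈ ((T).biUnion plaquetteEdges).filter (fun ℓ => ((T).filter fun p => ℓ ∈ plaquetteEdges p).card = 1), ∀ p' ∈ plaquettesTouching {ℓ}, p' ∉ T → ih (insert p' T) = true))
        (6) ((insert (![2,0,0,0], ⟨(1, 3), lt13⟩)
          ({(![0,0,0,0], ⟨(1, 2), lt12⟩), (![1,0,0,0], ⟨(0, 1), lt01⟩), (![0,0,0,0], ⟨(0, 1),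
              lt01⟩)} : Finset (ZdPlaquette 4)))) = true := by
  decide +kernel

set_option maxRecDepth 1000000 in
/-- Search certificate for branch 4, sub-branch 5 (kernel computation). -/
private theorem GS_branch4_5 :
    @Nat.rec (fun _ => Finset (ZdPlaquette 4) → Bool)
        (fun T => if ((T).biUnion plaquetteEdges).filter (fun ℓ => ((T).filter fun p => ℓ ∈ plaquetteEdges p).card =
            1) = ∅ then decide (T = ({(![0,0,0,0], ⟨(1, 2), lt12⟩), (![1,0,0,0], ⟨(0, 1), lt01⟩), (![2,0,0,0], ⟨(1,
            2), lt12⟩), (![0,0,0,0], ⟨(0, 1), lt01⟩), (![0,0,1,0], ⟨(0, 1), lt01⟩), (![0,0,0,0], ⟨(0, 2), lt02⟩),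
            (![0,1,0,0], ⟨(0, 2), lt02⟩), (![1,0,1,0], ⟨(0, 1), lt01⟩), (![1,0,0,0], ⟨(0, 2), lt02⟩), (![1,1,0,0],
            ⟨(0, 2), lt02⟩)} : Finset (ZdPlaquette 4))) else true)
        (fun k ih T => if ((T).biUnion plaquetteEdges).filter (fun ℓ => ((T).filter fun p => ℓ ∈ plaquetteEdges p).card = 1) = ∅ then decide (T = ({(![0,0,0,0], ⟨(1, 2), lt12⟩), (![1,0,0,0], ⟨(0, 1), lt01⟩), (![2,0,0,0], ⟨(1, 2), lt12⟩), (![0,0,0,0], ⟨(0, 1), lt01⟩), (![0,0,1,0], ⟨(0, 1), lt01⟩), (![0,0,0,0], ⟨(0, 2), lt02⟩), (![0,1,0,0], ⟨(0, 2), lt02⟩), (![1,0,1,0], ⟨(0, 1), lt01⟩), (![1,0,0,0], ⟨(0, 2), lt02⟩), (![1,1,0,0], ⟨(0, 2), lt02⟩)} : Finset (ZdPlaquette 4)))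
          else decide (4 * (k + 1) < (((T).biUnion plaquetteEdges).filter (fun ℓ => ((T).filter fun p => ℓ ∈ plaquetteEdges p).card = 1)).card) ||
            decide (∃ ℓ ∈ ((T).biUnion plaquetteEdges).filter (fun ℓ => ((T).filter fun p => ℓ ∈ plaquetteEdges p).card = 1), ∀ p' ∈ plaquettesTouching {ℓ}, p' ∉ T → ih (insert p' T) = true))
        (6) ((insert (![2,0,0,-1], ⟨(1, 3), lt13⟩)
          ({(![0,0,0,0], ⟨(1, 2), lt12⟩), (![1,0,0,0], ⟨(0, 1), lt01⟩), (![0,0,0,0], ⟨(0, 1),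
              lt01⟩)} : Finset (ZdPlaquette 4)))) = true := by
  decide +kernel

/-- The plaquettes of `ℤ⁴` containing the bond `((2, 0, 0, 0), 1)` (kernel computation). -/
private theorem plaquettesTouching_branch4 :
    plaquettesTouching ({((![2,0,0,0] : Fin 4 → ℤ), (1 : Fin 4))} : Finset (ZdEdge 4)) =
      ({(![2,0,0,0], ⟨(0, 1), lt01⟩), (![1,0,0,0], ⟨(0, 1), lt01⟩), (![2,0,0,0], ⟨(1, 2), lt12⟩), (![2,0,-1,0], ⟨(1,
          2), lt12⟩), (![2,0,0,0], ⟨(1, 3), lt13⟩), (![2,0,0,-1], ⟨(1, 3), lt13⟩)} : Finset (ZdPlaquette 4)) := by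
  decide +kernel

/-- **Branch 4 of the uniqueness of the box.** Every family of at most ten plaquettes of `ℤ⁴`
without private bonds containing `q₁`, `q₂` and the candidate `((0, 0, 0, 0), 0, 1)` contains the ten faces of
the box. -/
theorem box_branch4 (T : Finset (ZdPlaquette 4))
    (h0 : ({(![0,0,0,0], ⟨(1, 2), lt12⟩), (![1,0,0,0], ⟨(0, 1), lt01⟩), (![0,0,0,0], ⟨(0, 1),
        lt01⟩)} : Finset (ZdPlaquette 4)) ⊆ T)
    (hcard : T.card ≤ 10)
    (hN : ∀ p ∈ T, ∀ ℓ ∈ plaquetteEdges p, ∃ p' ∈ T, p' ≠ p ∧ ℓ ∈ plaquetteEdges p') :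
    ({(![0,0,0,0], ⟨(1, 2), lt12⟩), (![1,0,0,0], ⟨(0, 1), lt01⟩), (![2,0,0,0], ⟨(1, 2), lt12⟩), (![0,0,0,0], ⟨(0, 1),
        lt01⟩), (![0,0,1,0], ⟨(0, 1), lt01⟩), (![0,0,0,0], ⟨(0, 2), lt02⟩), (![0,1,0,0], ⟨(0, 2), lt02⟩),
        (![1,0,1,0], ⟨(0, 1), lt01⟩), (![1,0,0,0], ⟨(0, 2), lt02⟩), (![1,1,0,0], ⟨(0, 2),
        lt02⟩)} : Finset (ZdPlaquette 4)) ⊆ T := by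
  classical
  have hN' : ((T).biUnion plaquetteEdges).filter (fun ℓ => ((T).filter fun p => ℓ ∈ plaquetteEdges p).card = 1) = ∅ :=
    (PB_eq_empty_iff T).2 hN
  have hℓ : ((![2,0,0,0] : Fin 4 → ℤ), (1 : Fin 4)) ∈
      ((({(![0,0,0,0], ⟨(1, 2), lt12⟩), (![1,0,0,0], ⟨(0, 1), lt01⟩), (![0,0,0,0], ⟨(0, 1),
          lt01⟩)} : Finset (ZdPlaquette 4))).biUnion plaquetteEdges).filter (fun ℓ => ((({(![0,0,0,0], ⟨(1, 2),
          lt12⟩), (![1,0,0,0], ⟨(0, 1), lt01⟩), (![0,0,0,0], ⟨(0, 1),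
          lt01⟩)} : Finset (ZdPlaquette 4))).filter fun p => ℓ ∈ plaquetteEdges p).card = 1) := by decide +kernel
  obtain ⟨p'', hp'', hℓp''⟩ := exists_mem_sdiff_of_mem_PB h0 hN' hℓ
  obtain ⟨hp''T, hp''1⟩ := Finset.mem_sdiff.1 hp''
  have htouch : p'' ∈ plaquettesTouching ({((![2,0,0,0] : Fin 4 → ℤ), (1 : Fin 4))} : Finset (ZdEdge 4)) :=
    mem_plaquettesTouching_iff.2 ⟨_, Finset.mem_inter.2 ⟨hℓp'', Finset.mem_singleton_self _⟩⟩
  rw [plaquettesTouching_branch4] at htouch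
  have h3 : (({(![0,0,0,0], ⟨(1, 2), lt12⟩), (![1,0,0,0], ⟨(0, 1), lt01⟩), (![0,0,0,0], ⟨(0, 1),
      lt01⟩)} : Finset (ZdPlaquette 4))).card = 3 := by decide +kernel
  have h4 : ∀ p ∉ ({(![0,0,0,0], ⟨(1, 2), lt12⟩), (![1,0,0,0], ⟨(0, 1), lt01⟩), (![0,0,0,0], ⟨(0, 1),
      lt01⟩)} : Finset (ZdPlaquette 4)),
      (insert p ({(![0,0,0,0], ⟨(1, 2), lt12⟩), (![1,0,0,0], ⟨(0, 1), lt01⟩), (![0,0,0,0], ⟨(0, 1),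
          lt01⟩)} : Finset (ZdPlaquette 4))).card = 4 := fun p hp => by
    rw [Finset.card_insert_of_notMem hp, h3]
  simp only [Finset.mem_insert, Finset.mem_singleton] at htouch
  rcases htouch with rfl | rfl | rfl | rfl | rfl | rfl
  · exact subset_of_GS _ 6 _ GS_branch4_1 T (Finset.insert_subset hp''T h0)
      (by rw [h4 _ hp''1]; omega) hN'
  · exact absurd (by decide +kernel) hp''1
  · exact subset_of_GS _ 6 _ GS_branch4_2 T (Finset.insert_subset hp''T h0)
      (by rw [h4 _ hp''1]; omega) hN'
  · exact subset_of_GS _ 6 _ GS_branch4_3 T (Finset.insert_subset hp''T h0)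
      (by rw [h4 _ hp''1]; omega) hN'
  · exact subset_of_GS _ 6 _ GS_branch4_4 T (Finset.insert_subset hp''T h0)
      (by rw [h4 _ hp''1]; omega) hN'
  · exact subset_of_GS _ 6 _ GS_branch4_5 T (Finset.insert_subset hp''T h0)
      (by rw [h4 _ hp''1]; omega) hN'

end Summit.QuantumFields.YangMills.Theorems.S28OneBitBox
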